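import Literature.IUT.HodgeArakelov.LabelledDecompositionNonVacuity
import Literature.IUT.HodgeArakelov.FlTorsorStructureNonVacuity
import Literature.IUT.HodgeArakelov.LabCuspStructureNonVacuity
import HarnessLib

/-!
# [IUTchII] Def 2.3 (iii)–(v): the existence predicate `Def23_structures` holds IFF three printed numerical facts
# hold — `|LabCusp^±(Π_v)| = l`, `|LabCusp^±(Π̂^±_v)| = l`, `Π̂^cor_v/Π̂^±_v ≅ 𝔽_l^{⋊±}` (join of the NV-L6 wave)

S. Mochizuki, *Inter-universal Teichmüller theory II*, §2, Definition 2.3 (iii)–(v), kurims manuscript (Dec. 2020)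
pp. 68–69 ("one verifies immediately") [cite: Mochizuki2012, Def 2.3 (v) p.69] [claim: Mochizuki2012, status: disputed].

PROOF-ONLY file (abc-iut cell, wave-5 prover abc-iut-w5-d219 gen 2; join of the NV-L6 rows «LabelledDecomposition»
(`def23_structures_iff`, p419420, this seat), «FlTorsorStructure» (`FlTorsorStructure.nonempty_iff`, p419621) and
«LabCuspStructure» (`LabCuspStructure.nonempty_iff_nonempty_equiv`)). No `def`/`instance`/`structure`.

The typed existence predicate `Def23_structures Dec C` of abc-iut-L6-t1's `LabelClassesOfCusps.lean` (node
IUTchII:Def2.3(v): "the label-class structures exist over the group-theoretic data") is, over EVERY bad-place setting,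
Prop. 2.2 (i) decomposition datum `Dec`, `±`-tower `W` and cuspidal-inertia interface `C`, EQUIVALENT to the
conjunction of the three printed numerical facts about `(W, C)`:
(1) `LabCusp^±(Π_v)` has `l` elements (a chart `≃ 𝔽_l`; [IUTchI] Def 6.1 (iii)),
(2) `Π̂^cor_v/Π̂^±_v ≅ 𝔽_l^{⋊±}` (Def 2.3 (v)),
(3) `LabCusp^±(Π̂^±_v)` has `l` elements (the `𝔽^±_l`-torsor chart of Def 2.3 (v)).
So discharging the node at a genuine `(W, C)` = producing exactly these three iso-data there (NV rows «PlusMinusTower»,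
«CuspidalInertiaData»); nothing else of Def 2.3 (iii)–(v) is load-bearing AS TYPED (reading notes of the three NV files:
the action / `Π_{v•t}` fields are read off the charts).

Nothing here takes a side on [IUTchIII] Cor. 3.12; typed ≠ proved; «not yet witnessed» ≠ «vacuous».
-/

namespace Literature.IUT.HodgeArakelov

universe u

open Literature.IUT.HodgeTheaters

variable {S : BadPlaceSetting.{u}} {P : TopGroup.{u}} {T : TemperedCoverings S P}
  {D : EtaleThetaData S.toThetaSetting P} {W : PlusMinusTower T}

/-- **[IUTchII] Def 2.3 (iii)–(v) existence predicate = three printed numerical facts.** For every decomposition datum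
`Dec` and cuspidal-inertia interface `C` over a `±`-tower `W`:
`Def23_structures Dec C ↔ |LabCusp^±(Π_v)| = l ∧ Π̂^cor_v/Π̂^±_v ≅ 𝔽_l^{⋊±} ∧ |LabCusp^±(Π̂^±_v)| = l`
(each cardinality as the existence of a chart `≃ 𝔽_l`). [cite: Mochizuki2012, Def 2.3 (v) p.69] -/
theorem def23_structures_iff_isos (Dec : SubgraphDecomposition S T D) (C : CuspidalInertiaData W) :
    Def23_structures Dec C ↔
      Nonempty (LabCuspPM C W.piV W.piPM ≃ ZMod S.l) ∧
        Nonempty (W.Corhat ⧸ W.pmHat ≃* FlPM S.l) ∧ Nonempty (LabCuspPM C W.pmHat W.pmHat ≃ ZMod S.l) := by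
  rw [def23_structures_iff]
  constructor
  · rintro ⟨L, hF⟩
    exact ⟨(LabCuspStructure.nonempty_iff_nonempty_equiv (C := C)).mp ⟨L⟩, (FlTorsorStructure.nonempty_iff C).mp hF⟩
  · rintro ⟨hL, hq, hc⟩
    obtain ⟨L⟩ := (LabCuspStructure.nonempty_iff_nonempty_equiv (C := C)).mpr hL
    exact ⟨L, (FlTorsorStructure.nonempty_iff C).mpr ⟨hq, hc⟩⟩

/-- **Def 2.3 (iii)–(v) from the three iso-data** (the `←` direction as a term builder for consumers holding the
data at a genuine `(W, C)`). [cite: Mochizuki2012, Def 2.3 (v) p.69] -/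
theorem def23_structures_of_isos (Dec : SubgraphDecomposition S T D) (C : CuspidalInertiaData W)
    (eV : LabCuspPM C W.piV W.piPM ≃ ZMod S.l) (q : W.Corhat ⧸ W.pmHat ≃* FlPM S.l)
    (ePM : LabCuspPM C W.pmHat W.pmHat ≃ ZMod S.l) : Def23_structures Dec C :=
  (def23_structures_iff_isos Dec C).mpr ⟨⟨eV⟩, ⟨q⟩, ⟨ePM⟩⟩

/-- **Necessity, read the other way**: if `l ≥ 2` and the label set `LabCusp^±(Π_v)` is a subsingleton (e.g. a `C`
recognising NO cuspidal inertia subgroup), the Def 2.3 existence predicate FAILS — it is a genuine condition on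
`(W, C)`, not a tautology. [cite: Mochizuki2012, Def 2.3 (iii) p.68] -/
theorem not_def23_structures_of_subsingleton (Dec : SubgraphDecomposition S T D) (C : CuspidalInertiaData W)
    [Subsingleton (LabCuspPM C W.piV W.piPM)] (hl : 2 ≤ S.l) : ¬ Def23_structures Dec C := by
  rintro ⟨L, -, -⟩
  exact LabCuspStructure.not_nonempty_of_subsingleton (C := C) hl ⟨L⟩

end Literature.IUT.HodgeArakelov
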